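import Summits.Parity.BatemanHorn.Theses.AlmostPrimeZeros

/-!
# Crux `DiscMajorantLog` (stmt-Parity-17114), line `Sketch`: what the growing real segment CONTAINS —
Poisson-sharp upper tails of `s_f` along the system (stub `stub_poissonTailOfRealAxisGrowing`)

Support file for the registered skeleton `Cruxes/DiscMajorantLog/Lines/Sketch.lean` (rev 5) of the crux
`Summit.Parity.BatemanHorn.Theses.AlmostPrimeZeros.DiscMajorantLog`.  The open composition stub
`stub_realAxisGrowing` (positive real segment at growing tilt `T₀ ≤ t ≤ 1 + 3 log log x`, all systems) is, by
Chernoff/Legendre duality, AT LEAST Hardy–Ramanujan along the system at Poisson precision: writing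
`L = log log x` and taking `t = m/(kL)` in its conclusion,

  `#{n ≤ x : s_f(n) ≥ m} ≤ A · x · e^{−kL} (e k L / m)^m · e^{C (t−1) log((t−1)+2)}`,  `T₀ kL ≤ m ≤ (1+3L) kL`,

i.e. the Poisson(`kL`) tail `e^{−kL}(kL)^m/m!` up to the Stirling factor `√(2πm)` and the crux's own Γ-budget, for
all `m` up to `≍ (log log x)²` — the range no printed local law along a nonlinear system reaches (Tenenbaum 2018,
arXiv:1710.04877, Thm 1: `m ≤ R · log log x`).  This is the true direction of the "Legendre duality" of the card
`visible-divisor-certificates`; the converse stated there (`realAxisDiscMajorant_of_poissonTail` with a bounded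
`m`-range) does not hold as stated, because a bounded range cannot control `Σ_{m > 3kL²+kL} t^m N_m`.
Pure bookkeeping (Markov's inequality on `Σ_n t^{s_f(n)}` and `(log x)^{k(t−1)} t^{−m} = e^{−kL}(ekL/m)^m` at
`t = m/(kL)`); no number theory is used, so the statement is over an arbitrary system `f` and `k ≥ 1`.
-/

noncomputable section

namespace Summit.Parity.BatemanHorn.Cruxes.DiscMajorantLog.Sketch

open scoped BigOperators

namespace PoissonTail

/-- Markov/Chernoff step: for `t ≥ 1`, `#{n ∈ s : m ≤ e n} · t^m ≤ Σ_{n∈s} t^{e n}`. [folklore] -/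
theorem card_filter_mul_pow_le (s : Finset ℕ) (e : ℕ → ℕ) {t : ℝ} (ht : 1 ≤ t) (m : ℕ) :
    (((s.filter (fun n => m ≤ e n)).card : ℕ) : ℝ) * t ^ m ≤ ∑ n ∈ s, t ^ (e n) := by
  have ht0 : 0 ≤ t := zero_le_one.trans ht
  calc (((s.filter (fun n => m ≤ e n)).card : ℕ) : ℝ) * t ^ m
      = ∑ _n ∈ s.filter (fun n => m ≤ e n), t ^ m := by
        rw [Finset.sum_const, nsmul_eq_mul]
    _ ≤ ∑ n ∈ s.filter (fun n => m ≤ e n), t ^ (e n) := by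
        refine Finset.sum_le_sum fun n hn => ?_
        exact pow_le_pow_right₀ ht (Finset.mem_filter.1 hn).2
    _ ≤ ∑ n ∈ s, t ^ (e n) :=
        Finset.sum_le_sum_of_subset_of_nonneg (Finset.filter_subset _ _) (fun n _ _ => pow_nonneg ht0 _)

/-- The Legendre bookkeeping at the tilt `t = m/(κ log ℓ)`:
`ℓ^{κ(t−1)} / t^m = e^{−κ log ℓ} · (e κ log ℓ / m)^m` for `ℓ > 1`, `κ > 0`, `m ≥ 1`. [folklore] -/
theorem rpow_div_pow_eq {ℓ : ℝ} (hℓ : 1 < ℓ) {κ : ℝ} (hκ : 0 < κ) {m : ℕ} (hm : 1 ≤ m) :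
    ℓ ^ (κ * ((m : ℝ) / (κ * Real.log ℓ) - 1)) / ((m : ℝ) / (κ * Real.log ℓ)) ^ m =
      Real.exp (-(κ * Real.log ℓ)) * (Real.exp 1 * (κ * Real.log ℓ) / m) ^ m := by
  set Λ := Real.log ℓ with hΛ
  have hΛpos : 0 < Λ := Real.log_pos hℓ
  have hκΛ : 0 < κ * Λ := mul_pos hκ hΛpos
  have hm0 : (0 : ℝ) < m := by exact_mod_cast hm
  have hℓ0 : 0 < ℓ := by linarith
  have h1 : Real.log ℓ * (κ * ((m : ℝ) / (κ * Λ) - 1)) = (m : ℝ) - κ * Λ := by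
    rw [← hΛ]; field_simp
  rw [Real.rpow_def_of_pos hℓ0, h1, Real.exp_sub, ← Real.exp_one_pow]
  have h2 : (Real.exp 1 * (κ * Λ) / m) ^ m = Real.exp 1 ^ m / ((m : ℝ) / (κ * Λ)) ^ m := by
    rw [← div_pow]; congr 1; field_simp
  rw [h2, Real.exp_neg]
  field_simp

end PoissonTail

/-- **Stub `stub_poissonTailOfRealAxisGrowing` (what R-growing contains: Poisson-sharp tails along the system).**
If the conclusion of `stub_realAxisGrowing` holds for a system `f` of `k ≥ 1` polynomials with constants
`T₀ ≥ 1, A, C, x₀`, then for every `x ≥ x₀` with `log x > 1` and every `m` with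
`T₀·kL ≤ m ≤ (1+3L)·kL` (`L = log log x`),
`#{n ≤ x : m ≤ s_f(n)} ≤ A·x·e^{−kL}·(e k L/m)^m·exp(C (t−1) log((t−1)+2))` at `t = m/(kL)` — the Poisson(`kL`)
tail up to `√(2πm)` and the Γ-budget, for `m` up to `3k(log log x)² + k log log x`.  Markov's inequality on
`Σ_n t^{s_f(n)}` at `t = m/(kL)` and `(log x)^{k(t−1)} t^{−m} = e^{−kL}(ekL/m)^m`. [folklore] -/
theorem stub_poissonTailOfRealAxisGrowing :
    ∀ (k : ℕ) (f : Fin k → Polynomial ℤ) (T₀ A C : ℝ) (x₀ : ℕ), 1 ≤ k → 1 ≤ T₀ →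
      (∀ x : ℕ, x₀ ≤ x → ∀ t : ℝ, T₀ ≤ t → t - 1 ≤ 3 * Real.log (Real.log (x : ℝ)) →
        (∑ n ∈ Finset.range (x + 1), t ^ (∑ i, (((f i).eval (n : ℤ)).toNat.factorization.sum fun _ v => min v 2))) ≤
          A * (x : ℝ) * (Real.log (x : ℝ)) ^ ((k : ℝ) * (t - 1)) *
            Real.exp (C * (t - 1) * Real.log ((t - 1) + 2))) →
      ∀ x : ℕ, x₀ ≤ x → 1 < Real.log (x : ℝ) →
      ∀ m : ℕ, T₀ * ((k : ℝ) * Real.log (Real.log (x : ℝ))) ≤ m →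
        (m : ℝ) ≤ (1 + 3 * Real.log (Real.log (x : ℝ))) * ((k : ℝ) * Real.log (Real.log (x : ℝ))) →
        ((((Finset.range (x + 1)).filter (fun n : ℕ =>
            m ≤ ∑ i, (((f i).eval (n : ℤ)).toNat.factorization.sum fun _ v => min v 2))).card : ℕ) : ℝ) ≤
          A * (x : ℝ) * Real.exp (-((k : ℝ) * Real.log (Real.log (x : ℝ)))) *
            (Real.exp 1 * ((k : ℝ) * Real.log (Real.log (x : ℝ))) / m) ^ m *
            Real.exp (C * ((m : ℝ) / ((k : ℝ) * Real.log (Real.log (x : ℝ))) - 1) *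
              Real.log (((m : ℝ) / ((k : ℝ) * Real.log (Real.log (x : ℝ))) - 1) + 2)) := by
  intro k f T₀ A C x₀ hk hT₀ hR x hx hlogx m hm1 hm2
  set L : ℝ := Real.log (Real.log (x : ℝ)) with hL
  have hLpos : 0 < L := Real.log_pos hlogx
  have hk' : (1 : ℝ) ≤ k := by exact_mod_cast hk
  have hkL : 0 < (k : ℝ) * L := mul_pos (by linarith) hLpos
  set t : ℝ := (m : ℝ) / ((k : ℝ) * L) with ht
  have htT : T₀ ≤ t := by rw [ht, le_div_iff₀ hkL]; exact hm1
  have ht1 : 1 ≤ t := hT₀.trans htT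
  have ht3 : t - 1 ≤ 3 * L := by
    rw [ht, div_sub_one (ne_of_gt hkL), div_le_iff₀ hkL]
    nlinarith [hm2, hkL.le]
  have hmain := hR x hx t htT ht3
  set e : ℕ → ℕ := fun n => ∑ i, (((f i).eval (n : ℤ)).toNat.factorization.sum fun _ v => min v 2) with he
  have hcheb := PoissonTail.card_filter_mul_pow_le (Finset.range (x + 1)) e ht1 m
  have htm : 0 < t ^ m := pow_pos (by linarith) m
  have hcard : ((((Finset.range (x + 1)).filter (fun n => m ≤ e n)).card : ℕ) : ℝ) ≤
      A * (x : ℝ) * (Real.log (x : ℝ)) ^ ((k : ℝ) * (t - 1)) *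
        Real.exp (C * (t - 1) * Real.log ((t - 1) + 2)) / t ^ m := by
    rw [le_div_iff₀ htm]; exact hcheb.trans hmain
  have hm0 : 1 ≤ m := by
    rcases Nat.eq_zero_or_pos m with h0 | hpos
    · exfalso
      subst h0
      have : T₀ * ((k : ℝ) * L) ≤ 0 := by simpa using hm1
      nlinarith
    · exact hpos
  have key : (Real.log (x : ℝ)) ^ ((k : ℝ) * (t - 1)) / t ^ m =
      Real.exp (-((k : ℝ) * L)) * (Real.exp 1 * ((k : ℝ) * L) / m) ^ m :=
    PoissonTail.rpow_div_pow_eq hlogx (by linarith) hm0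
  have hcard' : ((((Finset.range (x + 1)).filter (fun n => m ≤ e n)).card : ℕ) : ℝ) ≤
      A * (x : ℝ) * (Real.exp (-((k : ℝ) * L)) * (Real.exp 1 * ((k : ℝ) * L) / m) ^ m) *
        Real.exp (C * (t - 1) * Real.log ((t - 1) + 2)) := by
    have h := hcard
    rw [show A * (x : ℝ) * (Real.log (x : ℝ)) ^ ((k : ℝ) * (t - 1)) *
          Real.exp (C * (t - 1) * Real.log ((t - 1) + 2)) / t ^ m =
        A * (x : ℝ) * ((Real.log (x : ℝ)) ^ ((k : ℝ) * (t - 1)) / t ^ m) *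
          Real.exp (C * (t - 1) * Real.log ((t - 1) + 2)) by ring, key] at h
    exact h
  exact le_of_le_of_eq hcard' (by ring)

end Summit.Parity.BatemanHorn.Cruxes.DiscMajorantLog.Sketch

end
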